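import Summits.AtomisticToContinuum.HydrodynamicLimit.Theorems.AntiMazurCoboundariesCellForecastPressureDecayEnskogObjectsB
import Summits.AtomisticToContinuum.HydrodynamicLimit.Theorems.AntiMazurCoboundariesCellForecastPressureDecayKinematicAssemblyFreshPair
import Summits.AtomisticToContinuum.HydrodynamicLimit.Theorems.AntiMazurCoboundariesCellForecastPressureDecayKinematicAssemblyMainTerm
import HarnessLib

/-!
# S2e(B) · the short-time cluster tail, piece 2: charging a collision to Boltzmann's cylinder at a grid time
# (registered sub-goal `stub_clusterTail_charging` of stub `stub_clusterTail`, crux line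
# `enskog-compensator-martingale`, crux `CellForecastPressureDecay`, stmt-AtomisticToContinuum-13915)

The static event to which a collision at time `T` of two spheres that move affinely on `[a, T)` is charged: their
relative data at the grid time `a < T ≤ a + h` lie in Boltzmann's collision cylinder of length `h`, written as a
JOINTLY measurable relation of (relative position, relative velocity) so that it can be evaluated along measurable
flow maps and integrated by Tonelli:

* `exists_cylinder_iff_pairHits` — the cylinder `{σ ω − t u : ω ∈ S², ⟪ω, u⟫ < 0, t ∈ (0, h]}` of the landed
  cylinder identity (`volume_collisionCylinder`, piece S2d) in hitting-time form: `PairHits σ q u`, positive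
  discriminant, `pairHitTime σ q u ∈ (0, h]` (`HardSphereBilliard`); `measurableSet_cylRel` (joint
  measurability), `volume_cylRel_section_le` / `lintegral_indicator_cylRel_sub_le` (every translate of a section
  has volume `≤ σ² h ‖u‖ |S²|`);
* `cylRel_of_affine_contact` — **the charging lemma**: affine motion of `p ≠ q` on `[a, T)` and contact at
  `T ∈ (a, a + h]` put `(X_p − X_q, V_p − V_q)` in the cylinder relation (the left limit of the trajectory at `T`
  is incoming — no grazing on a hard-sphere trajectory — hence the hit is transversal);
* `eventually_exists_grid` — every fine enough mesh `h = Δ/M` has a grid time `a = kh < T ≤ a + h`, `k < M`,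
  within any prescribed gap below `T`;
* `stub_clusterTail_charging` — the registered form along the whole-cell flows of the line.

References: Cercignani–Illner–Pulvirenti 1994, §2.2 (collision cylinders), App. 4.A; Gallagher–Saint-Raymond–Texier
2013, §4.1 Def. 4.1.2.
-/

noncomputable section

open MeasureTheory ProbabilityTheory Set Filter Topology
open scoped ENNReal BigOperators InnerProductSpace
open Literature.Analysis.FluidPDE Literature.MathematicalPhysics.KineticTheory

namespace Summit.AtomisticToContinuum.HydrodynamicLimit.Theorems.EnskogCompensator

/-! ## Boltzmann's collision cylinder as a jointly measurable relation of (relative position, relative velocity) -/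

section Cylinder

/-- **The collision cylinder in hitting-time form.** For `σ > 0`, the relative position `q` lies in Boltzmann's
collision cylinder `{σ ω − t u : ω ∈ S², ⟪ω, u⟫ < 0, t ∈ (0, h]}` of the relative velocity `u` iff the free pair
`(q, u)` hits transversally (`PairHits`, positive discriminant) with first hitting time in `(0, h]`. [cite: CIP1994, §2.2] -/
theorem exists_cylinder_iff_pairHits {σ : ℝ} (hσ : 0 < σ) (h : ℝ) (q u : V3) :
    (∃ (ω : Metric.sphere (0 : V3) 1) (t : ℝ), t ∈ Ioc 0 h ∧ ⟪(ω : V3), u⟫_ℝ < 0 ∧ q = σ • (ω : V3) - t • u) ↔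
      PairHits σ q u ∧ 0 < pairDisc σ q u ∧ pairHitTime σ q u ∈ Ioc 0 h := by
  constructor
  · rintro ⟨ω, t, ht, hωu, rfl⟩
    obtain ⟨hhits, htime⟩ := collisionCylinder_pairHits hσ u ω ht.1 hωu
    refine ⟨hhits, ?_, htime.symm ▸ ht⟩
    have h1 := inner_add_pairHitTime_smul hhits
    rw [htime, sub_add_cancel, real_inner_smul_left] at h1
    have h2 : σ * ⟪(ω : V3), u⟫_ℝ < 0 := mul_neg_of_pos_of_neg hσ hωu
    have h3 : 0 < Real.sqrt (pairDisc σ (σ • (ω : V3) - t • u) u) := by linarith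
    exact Real.sqrt_pos.1 h3
  · rintro ⟨hhits, hdisc, ht⟩
    set t := pairHitTime σ q u with htdef
    have hnorm : ‖q + t • u‖ = σ := norm_add_pairHitTime_smul hσ.le hhits
    have hin : ⟪q + t • u, u⟫_ℝ < 0 := by
      rw [inner_add_pairHitTime_smul hhits]
      exact neg_lt_zero.2 (Real.sqrt_pos.2 hdisc)
    refine ⟨⟨σ⁻¹ • (q + t • u), ?_⟩, t, ht, ?_, ?_⟩
    · rw [mem_sphere_zero_iff_norm, norm_smul, norm_inv, Real.norm_of_nonneg hσ.le, hnorm,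
        inv_mul_cancel₀ hσ.ne']
    · change ⟪σ⁻¹ • (q + t • u), u⟫_ℝ < 0
      rw [real_inner_smul_left]
      exact mul_neg_of_pos_of_neg (inv_pos.2 hσ) hin
    · change q = σ • (σ⁻¹ • (q + t • u)) - t • u
      rw [smul_smul, mul_inv_cancel₀ hσ.ne', one_smul, add_sub_cancel_right]

/-- **Charging a transversal contact to the cylinder**: if the free pair `(q, u)` is at distance `σ` and incoming
at a time `t ∈ (0, h]`, then `(q, u)` lies in the cylinder relation of length `h`. [cite: CIP1994, §2.2] -/
theorem pairHits_of_contact {σ : ℝ} (hσ : 0 < σ) {h t : ℝ} {q u : V3} (ht : t ∈ Ioc 0 h)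
    (hnorm : ‖q + t • u‖ = σ) (hin : ⟪q + t • u, u⟫_ℝ < 0) :
    PairHits σ q u ∧ 0 < pairDisc σ q u ∧ pairHitTime σ q u ∈ Ioc 0 h := by
  rw [← exists_cylinder_iff_pairHits hσ]
  refine ⟨⟨σ⁻¹ • (q + t • u), ?_⟩, t, ht, ?_, ?_⟩
  · rw [mem_sphere_zero_iff_norm, norm_smul, norm_inv, Real.norm_of_nonneg hσ.le, hnorm,
      inv_mul_cancel₀ hσ.ne']
  · change ⟪σ⁻¹ • (q + t • u), u⟫_ℝ < 0
    rw [real_inner_smul_left]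
    exact mul_neg_of_pos_of_neg (inv_pos.2 hσ) hin
  · change q = σ • (σ⁻¹ • (q + t • u)) - t • u
    rw [smul_smul, mul_inv_cancel₀ hσ.ne', one_smul, add_sub_cancel_right]

/-- The cylinder relation `{(q, u) : PairHits, disc > 0, hitting time ∈ (0, h]}` is a (jointly) measurable subset
of `ℝ³ × ℝ³`. [folklore] -/
theorem measurableSet_cylRel (σ h : ℝ) :
    MeasurableSet {p : V3 × V3 | PairHits σ p.1 p.2 ∧ 0 < pairDisc σ p.1 p.2 ∧ pairHitTime σ p.1 p.2 ∈ Ioc 0 h} := by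
  have hinner : Continuous fun p : V3 × V3 => ⟪p.1, p.2⟫_ℝ := continuous_inner
  have hdisc : Continuous fun p : V3 × V3 => pairDisc σ p.1 p.2 := by
    unfold pairDisc; fun_prop
  have htime : Measurable fun p : V3 × V3 => pairHitTime σ p.1 p.2 := by
    unfold pairHitTime
    exact ((hinner.neg.sub (hdisc.sqrt)).measurable).div (by fun_prop)
  refine ((measurableSet_lt hinner.measurable measurable_const).inter
    (measurableSet_le measurable_const hdisc.measurable)).inter
    ((measurableSet_lt measurable_const hdisc.measurable).inter
      ((measurableSet_lt measurable_const htime).inter (measurableSet_le htime measurable_const)))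

/-- **Volume of a section of the cylinder relation**: `vol{q : (q, u) ∈ Cyl_h} ≤ σ² h ‖u‖ · |S²|`
(exact value `π σ² h ‖u‖`). [cite: CIP1994, §2.2] -/
theorem volume_cylRel_section_le {σ : ℝ} (hσ : 0 < σ) (h : ℝ) (u : V3) :
    volume {q : V3 | PairHits σ q u ∧ 0 < pairDisc σ q u ∧ pairHitTime σ q u ∈ Ioc 0 h} ≤
      ENNReal.ofReal (σ ^ 2 * h * ‖u‖) * sphereMeasure (Set.univ : Set (Metric.sphere (0 : V3) 1)) := by
  have hset : {q : V3 | PairHits σ q u ∧ 0 < pairDisc σ q u ∧ pairHitTime σ q u ∈ Ioc 0 h} =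
      {q : V3 | ∃ (ω : Metric.sphere (0 : V3) 1) (t : ℝ), t ∈ Ioc 0 h ∧ ⟪(ω : V3), u⟫_ℝ < 0 ∧
        q = σ • (ω : V3) - t • u} := by
    ext q; exact (exists_cylinder_iff_pairHits hσ h q u).symm
  rw [hset, volume_collisionCylinder hσ u h]
  rcases le_or_gt 0 h with hh | hh
  · have hle : ∫⁻ ω : Metric.sphere (0 : V3) 1, ENNReal.ofReal (max (-⟪(ω : V3), u⟫_ℝ) 0) ∂sphereMeasure ≤
        ∫⁻ _ω : Metric.sphere (0 : V3) 1, ENNReal.ofReal ‖u‖ ∂sphereMeasure := by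
      refine lintegral_mono fun ω => ENNReal.ofReal_le_ofReal (max_le ?_ (norm_nonneg u))
      have h1 : |⟪(ω : V3), u⟫_ℝ| ≤ ‖(ω : V3)‖ * ‖u‖ := abs_real_inner_le_norm _ _
      have h2 : ‖(ω : V3)‖ = 1 := by simp
      rw [h2, one_mul] at h1
      linarith [neg_abs_le ⟪(ω : V3), u⟫_ℝ]
    calc ENNReal.ofReal (σ ^ 2 * h) * ∫⁻ ω : Metric.sphere (0 : V3) 1,
          ENNReal.ofReal (max (-⟪(ω : V3), u⟫_ℝ) 0) ∂sphereMeasure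
        ≤ ENNReal.ofReal (σ ^ 2 * h) * ∫⁻ _ω : Metric.sphere (0 : V3) 1, ENNReal.ofReal ‖u‖ ∂sphereMeasure :=
          mul_le_mul' le_rfl hle
      _ = ENNReal.ofReal (σ ^ 2 * h * ‖u‖) * sphereMeasure (Set.univ : Set (Metric.sphere (0 : V3) 1)) := by
          rw [lintegral_const, ← mul_assoc, ← ENNReal.ofReal_mul (by positivity)]
  · have : ENNReal.ofReal (σ ^ 2 * h) = 0 := ENNReal.ofReal_eq_zero.2 (by nlinarith [sq_nonneg σ])
    rw [this, zero_mul]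
    exact bot_le

/-- Translates of a section have the same volume: `vol{y : (y − c, u) ∈ Cyl_h} = vol{q : (q, u) ∈ Cyl_h}`. [folklore] -/
theorem volume_cylRel_section_sub (σ h : ℝ) (u c : V3) :
    volume {y : V3 | PairHits σ (y - c) u ∧ 0 < pairDisc σ (y - c) u ∧ pairHitTime σ (y - c) u ∈ Ioc 0 h} =
      volume {q : V3 | PairHits σ q u ∧ 0 < pairDisc σ q u ∧ pairHitTime σ q u ∈ Ioc 0 h} := by
  have : {y : V3 | PairHits σ (y - c) u ∧ 0 < pairDisc σ (y - c) u ∧ pairHitTime σ (y - c) u ∈ Ioc 0 h} =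
      (fun y : V3 => y + -c) ⁻¹' {q : V3 | PairHits σ q u ∧ 0 < pairDisc σ q u ∧ pairHitTime σ q u ∈ Ioc 0 h} := by
    ext y; simp [sub_eq_add_neg]
  rw [this, measure_preimage_add_right]

/-- **The lintegral form**: for every `c`, `∫ 1_{Cyl_h}(y − c, u) dy ≤ σ² h ‖u‖ |S²|`. [cite: CIP1994, §2.2] -/
theorem lintegral_indicator_cylRel_sub_le {σ : ℝ} (hσ : 0 < σ) (h : ℝ) (u c : V3) :
    ∫⁻ y : V3, {p : V3 × V3 | PairHits σ p.1 p.2 ∧ 0 < pairDisc σ p.1 p.2 ∧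
        pairHitTime σ p.1 p.2 ∈ Ioc 0 h}.indicator 1 (y - c, u) ≤
      ENNReal.ofReal (σ ^ 2 * h * ‖u‖) * sphereMeasure (Set.univ : Set (Metric.sphere (0 : V3) 1)) := by
  have hset : MeasurableSet {y : V3 | PairHits σ (y - c) u ∧ 0 < pairDisc σ (y - c) u ∧
      pairHitTime σ (y - c) u ∈ Ioc 0 h} :=
    (measurableSet_cylRel σ h).preimage (by fun_prop : Measurable fun y : V3 => (y - c, u))
  have hfun : (fun y : V3 => {p : V3 × V3 | PairHits σ p.1 p.2 ∧ 0 < pairDisc σ p.1 p.2 ∧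
      pairHitTime σ p.1 p.2 ∈ Ioc 0 h}.indicator (1 : V3 × V3 → ℝ≥0∞) (y - c, u)) =
      {y : V3 | PairHits σ (y - c) u ∧ 0 < pairDisc σ (y - c) u ∧ pairHitTime σ (y - c) u ∈ Ioc 0 h}.indicator 1 := by
    funext y
    simp only [Set.indicator, Set.mem_setOf_eq, Pi.one_apply]
    congr 1
  rw [hfun, lintegral_indicator_one hset, volume_cylRel_section_sub]
  exact volume_cylRel_section_le hσ h u

end Cylinder

/-! ## Charging a collision to the cylinder at an earlier grid time -/

section Charging

/-- **Left limits along an affine stretch**: if sphere `p` moves affinely on `[a, T)`, `a < T`, then its left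
limit at `T` is the extrapolated state. [folklore] -/
theorem apply_eq_of_tendsto_of_affine {N : ℕ} {γ : ℝ → Cell N} {zl : Cell N} {T a : ℝ} (haT : a < T)
    (hzl : Tendsto γ (𝓝[<] T) (𝓝 zl)) {p : Fin N} {X V : V3}
    (hp : ∀ s ∈ Ico a T, γ s p = (X + (s - a) • V, V)) : zl p = (X + (T - a) • V, V) := by
  have h1 : Tendsto (fun s => γ s p) (𝓝[<] T) (𝓝 (zl p)) := ((continuous_apply p).tendsto zl).comp hzl
  have h2 : Tendsto (fun s => γ s p) (𝓝[<] T) (𝓝 (X + (T - a) • V, V)) := by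
    have hc : Continuous fun s : ℝ => (X + (s - a) • V, V) := by fun_prop
    refine ((hc.tendsto T).mono_left nhdsWithin_le_nhds).congr' ?_
    filter_upwards [Ioo_mem_nhdsLT haT] with s hs
    exact (hp s ⟨hs.1.le, hs.2⟩).symm
  exact tendsto_nhds_unique h1 h2

/-- **The charging lemma.** On a hard-sphere trajectory in `ℝ³`, if the spheres `p ≠ q` move affinely on
`[a, T)` — `x_p(s) = X_p + (s − a) V_p`, `x_q(s) = X_q + (s − a) V_q` — and are in contact at time `T ∈ (a, a + h]`,
then the relative data `(X_p − X_q, V_p − V_q)` at time `a` lie in the cylinder relation of length `h`: the free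
pair hits transversally (the pre-collisional left limit is incoming, no grazing) with first hitting time
`T − a ∈ (0, h]`. [cite: GST2013, §4.1 Def. 4.1.2] -/
theorem cylRel_of_affine_contact {N : ℕ} {σ : ℝ} (hσ : 0 < σ) {γ : ℝ → Cell N}
    (hγ : IsHardSphereTrajectory (Euclidean.geometry (Fin 3)) σ N γ) {p q : Fin N} (hpq : p ≠ q)
    {a T h : ℝ} (haT : a < T) (hTh : T ≤ a + h) {Xp Vp Xq Vq : V3}
    (hp : ∀ s ∈ Ico a T, γ s p = (Xp + (s - a) • Vp, Vp)) (hq : ∀ s ∈ Ico a T, γ s q = (Xq + (s - a) • Vq, Vq))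
    (hc : γ T ∈ contactSet (Euclidean.geometry (Fin 3)) N σ p q) :
    PairHits σ (Xp - Xq) (Vp - Vq) ∧ 0 < pairDisc σ (Xp - Xq) (Vp - Vq) ∧
      pairHitTime σ (Xp - Xq) (Vp - Vq) ∈ Ioc 0 h := by
  obtain ⟨-, zl, hzl, hin, heq⟩ := hγ.binary T p q hpq hc
  have hlp := apply_eq_of_tendsto_of_affine haT hzl hp
  have hlq := apply_eq_of_tendsto_of_affine haT hzl hq
  have hnorm : ‖(zl p).1 - (zl q).1‖ = σ := by
    have h1 := (mem_contactSet.1 hc).2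
    rw [heq, collidePair_apply_fst, collidePair_apply_fst] at h1
    simpa using h1
  have hin' : ⟪(zl p).1 - (zl q).1, (zl p).2 - (zl q).2⟫_ℝ < 0 := hin
  rw [hlp, hlq] at hnorm hin'
  simp only at hnorm hin'
  rw [sub_add_smul_sub] at hnorm hin'
  exact pairHits_of_contact hσ ⟨sub_pos.2 haT, by linarith⟩ hnorm hin'

/-- **The time mesh.** For `0 < T ≤ Δ` and a gap `g > 0`, every fine enough mesh `h = Δ/M` has a grid time
`a = k h`, `k < M`, with `a < T ≤ a + h` and `T − g < a`. [folklore] -/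
theorem eventually_exists_grid {Δ T g : ℝ} (hT : 0 < T) (hTΔ : T ≤ Δ) (hg : 0 < g) :
    ∀ᶠ M : ℕ in atTop, ∃ k : ℕ, k < M ∧ (k : ℝ) * (Δ / M) < T ∧ T ≤ ((k : ℝ) + 1) * (Δ / M) ∧
      T - g < (k : ℝ) * (Δ / M) := by
  have hΔ : 0 < Δ := hT.trans_le hTΔ
  filter_upwards [eventually_gt_atTop ⌈Δ / g⌉₊] with M hM
  have hM0 : (0 : ℝ) < M := by exact_mod_cast (Nat.zero_le _).trans_lt hM
  have hMg : Δ / g < M := (Nat.le_ceil (Δ / g)).trans_lt (by exact_mod_cast hM)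
  set h : ℝ := Δ / M with hh
  have hh0 : 0 < h := div_pos hΔ hM0
  have hhg : h < g := by
    rw [hh, div_lt_iff₀ hM0]
    rw [div_lt_iff₀ hg] at hMg
    linarith
  have hTh : 0 < T / h := div_pos hT hh0
  set k : ℕ := ⌈T / h⌉₊ - 1 with hk
  have hceil : 1 ≤ ⌈T / h⌉₊ := Nat.one_le_iff_ne_zero.2 (Nat.pos_iff_ne_zero.1 (Nat.ceil_pos.2 hTh))
  have hk1 : ((k : ℕ) : ℝ) + 1 = ⌈T / h⌉₊ := by
    rw [hk, Nat.cast_sub hceil, Nat.cast_one, sub_add_cancel]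
  have hklt : (k : ℝ) < T / h := by
    have := Nat.ceil_lt_add_one hTh.le
    linarith
  have hkle : T / h ≤ (k : ℝ) + 1 := by rw [hk1]; exact Nat.le_ceil _
  refine ⟨k, ?_, ?_, ?_, ?_⟩
  · have : (k : ℝ) < M := by
      refine hklt.trans_le ?_
      rw [div_le_iff₀ hh0, hh, mul_div_cancel₀ _ hM0.ne']
      exact hTΔ
    exact_mod_cast this
  · rwa [← lt_div_iff₀ hh0]
  · rwa [← div_le_iff₀ hh0]
  · have : T ≤ (k : ℝ) * h + h := by
      have := (div_le_iff₀ hh0).1 hkle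
      linarith [this]
    linarith

end Charging


/-! ## The registered sub-goal -/

/-- **Registered sub-goal `stub_clusterTail_charging`** (piece of stub `stub_clusterTail`, S2e, of the line
`enskog-compensator-martingale`): **charging a collision of the whole-cell flow to the collision cylinder at an
earlier time.** Along the whole-cell hard-sphere flow of a good datum, if the spheres `p ≠ q` move affinely on
`[a, T)` (`x_p(s) = X_p + (s − a)V_p`, `x_q(s) = X_q + (s − a)V_q`) and are in contact at time `T ∈ (a, a + h]`, then
the free pair `(X_p − X_q, V_p − V_q)` hits transversally with first hitting time in `(0, h]` — a static event of
volume `≤ σ² h ‖V_p − V_q‖ |S²|` in the relative position (`lintegral_indicator_cylRel_sub_le`).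
[cite: CIP1994, §2.2] -/
theorem stub_clusterTail_charging : ∀ (σ : ℝ) (N : ℕ) (Ψ : Flows σ) (z : Cell N), 0 < σ → z ∈ (Ψ N).good →
    ∀ (p q : Fin N) (a T h : ℝ) (Xp Vp Xq Vq : V3), p ≠ q → a < T → T ≤ a + h →
      (∀ s ∈ Set.Ico a T, (Ψ N).flow s z p = (Xp + (s - a) • Vp, Vp)) →
      (∀ s ∈ Set.Ico a T, (Ψ N).flow s z q = (Xq + (s - a) • Vq, Vq)) →
      (Ψ N).flow T z ∈ contactSet (Euclidean.geometry (Fin 3)) N σ p q →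
        PairHits σ (Xp - Xq) (Vp - Vq) ∧ 0 < pairDisc σ (Xp - Xq) (Vp - Vq) ∧
          pairHitTime σ (Xp - Xq) (Vp - Vq) ∈ Set.Ioc 0 h :=
  fun _ N Ψ z hσ hz _ _ _ _ _ _ _ _ _ hpq haT hTh hp hq hc =>
    cylRel_of_affine_contact hσ ((Ψ N).isTrajectory z hz) hpq haT hTh hp hq hc

end Summit.AtomisticToContinuum.HydrodynamicLimit.Theorems.EnskogCompensator

end
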